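import Summits.AtomisticToContinuum.FouriersLaw.Theorems.VanishingNoiseTransferVanishingNoiseBoundUniformAsymmetryTransfer
import Summits.AtomisticToContinuum.FouriersLaw.Theorems.VanishingNoiseTransferVanishingNoiseBoundNessFlipAsymmetryLipschitz

/-!
# Fixed-length noise continuity of the linear response of the pinned chain (line `fekete-usc-one-length`,
crux stmt-AtomisticToContinuum-11976 `VanishingNoiseTransfer.VanishingNoiseBound`; the planner's stub S2, PROVED)

`--supports stmt-AtomisticToContinuum-11976` file. The ORIGINAL second stub of the line's skeleton
(`Cruxes/VanishingNoiseBound/Lines/fekete_usc_one_length.lean`, planner round 1), now a theorem: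

* `response_continuous_in_flipRate` (registered one-line form: `fixedLengthNoiseContinuity`) — for `pinnedChain ω₂ lam β γ` (all parameters `> 0`), `T > 0` and EVERY
  length `N`: if `μ0 T_L T_R` is THE unique weak steady state (`IsSteadyState`) at length `N` for all
  `T_L, T_R > 0`, with linear-response coefficient `D0 = lim_{δ→0, δ≠0} totalCurrent(μ0_{T+δ/2,T−δ/2})/δ`,
  then for every `η > 0` there is `ε₂ > 0` such that for all flip rates `ε ∈ (0, ε₂]`, THE unique weak
  flip-steady family `με` (`IsFlipSteadyState`, velocity flips at every site at rate `ε`) at length `N` and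
  any response coefficient `Dε` of it at `T` satisfy `|Dε − D0| ≤ η`: the finite-`N` response is continuous
  in the flip rate at `ε = 0⁺` (the frame of the sibling crux `NoiseLocality`, stmt-11975, at ONE length,
  without any `N`-uniformity).

Proof = the chain of landed helper files of the line (waves 1–3): the flip steady state is `π R_{Nε}`
(resolvent-kernel bind), `‖flip NESS − NESS‖_{e^{θH}} ≤ 2MNε · Asym(NESS)` (flip-asymmetry transfer),
the uniform two-parameter transfer bound `|J(με,δ) − J(μ0,δ)| ≤ K ε |δ|` and Moore–Osgood
(`FixedLengthNoiseContinuity.of_uniformAsymmetryTransfer`, `…FlipAsymmetryTransferPinned.lean`), fed with the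
two deterministic-chain inputs (UA) `stub_uniformAsymmetryTransfer` (temperature-uniform Harris constants near
equilibrium, `…UniformAsymmetryTransfer.lean`) and (AS) `stub_nessFlipAsymmetryLipschitz` (the NESS is
`O(δ)`-close to the Gibbs measure in the weighted dual norm, `…NessFlipAsymmetryLipschitz.lean`). No derivative
of any steady state in the bias and no flip semigroup is used. No definitions.
-/

noncomputable section

namespace Summit.AtomisticToContinuum.FouriersLaw.Theorems.FixedLengthNoiseContinuity

open MeasureTheory Filter Topology
open Literature.MathematicalPhysics.KineticTheory.HeatConduction

/-- **Fixed-length noise continuity of the response (stub S2 of line `fekete-usc-one-length`, proved).**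
For `pinnedChain ω₂ lam β γ` (all `> 0`), `T > 0`, any `N`, the unique weak steady family `μ0` with response
`D0` at `T`: for every `η > 0` there is `ε₂ > 0` such that for all `ε ∈ (0, ε₂]`, the unique weak flip-steady
family `με` at rate `ε` and any response `Dε` of it at `T` satisfy `|Dε − D0| ≤ η`.
[Bernardin–Olla 2011, §2.1 (model); Cuneo–Eckmann–Hairer–Rey-Bellet 2018, Thm 2.13; Hairer–Majda 2009, §2] -/
theorem response_continuous_in_flipRate :
    ∀ ω₂ lam β γ : ℝ, 0 < ω₂ → 0 < lam → 0 < β → 0 < γ → ∀ T : ℝ, 0 < T → ∀ N : ℕ,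
      ∀ μ0 : ℝ → ℝ → Measure (PhaseSpace N),
        (∀ T_L T_R : ℝ, 0 < T_L → 0 < T_R →
          (pinnedChain ω₂ lam β γ).IsSteadyState N T_L T_R (μ0 T_L T_R) ∧
            ∀ ν : Measure (PhaseSpace N),
              (pinnedChain ω₂ lam β γ).IsSteadyState N T_L T_R ν → ν = μ0 T_L T_R) →
        ∀ D0 : ℝ,
          Tendsto (fun δ : ℝ =>
            (pinnedChain ω₂ lam β γ).totalCurrent (μ0 (T + δ / 2) (T - δ / 2)) / δ)
            (𝓝[≠] 0) (𝓝 D0) →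
          ∀ η : ℝ, 0 < η → ∃ ε₂ : ℝ, 0 < ε₂ ∧ ∀ ε : ℝ, 0 < ε → ε ≤ ε₂ →
            ∀ με : ℝ → ℝ → Measure (PhaseSpace N),
              (∀ T_L T_R : ℝ, 0 < T_L → 0 < T_R →
                (pinnedChain ω₂ lam β γ).IsFlipSteadyState N T_L T_R ε (με T_L T_R) ∧
                  ∀ ν : Measure (PhaseSpace N),
                    (pinnedChain ω₂ lam β γ).IsFlipSteadyState N T_L T_R ε ν → ν = με T_L T_R) →
              ∀ Dε : ℝ,
                Tendsto (fun δ : ℝ =>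
                  (pinnedChain ω₂ lam β γ).totalCurrent (με (T + δ / 2) (T - δ / 2)) / δ)
                  (𝓝[≠] 0) (𝓝 Dε) →
                |Dε - D0| ≤ η := by
  intro ω₂ lam β γ hω hl hβ hγ T hT N μ0 hμ0 D0 hD0
  exact of_uniformAsymmetryTransfer hT μ0 hD0
    (stub_uniformAsymmetryTransfer ω₂ lam β γ hω hl hβ hγ T hT N μ0 hμ0)
    (stub_nessFlipAsymmetryLipschitz ω₂ lam β γ hω hl hβ hγ T hT N μ0 hμ0)

/-- Registered sub-goal `fixedLengthNoiseContinuity` of stmt-AtomisticToContinuum-11976 (the planner's stub S2 of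
line `fekete-usc-one-length`, notation-free one-line form; = `response_continuous_in_flipRate`). -/
theorem fixedLengthNoiseContinuity : ∀ ω₂ lam β γ : ℝ, 0 < ω₂ → 0 < lam → 0 < β → 0 < γ → ∀ T : ℝ, 0 < T → ∀ N : ℕ, ∀ μ0 : ℝ → ℝ → MeasureTheory.Measure (Literature.MathematicalPhysics.KineticTheory.HeatConduction.PhaseSpace N), (∀ T_L T_R : ℝ, 0 < T_L → 0 < T_R → (Literature.MathematicalPhysics.KineticTheory.HeatConduction.pinnedChain ω₂ lam β γ).IsSteadyState N T_L T_R (μ0 T_L T_R) ∧ ∀ ν : MeasureTheory.Measure (Literature.MathematicalPhysics.KineticTheory.HeatConduction.PhaseSpace N), (Literature.MathematicalPhysics.KineticTheory.HeatConduction.pinnedChain ω₂ lam β γ).IsSteadyState N T_L T_R ν → ν = μ0 T_L T_R) → ∀ D0 : ℝ, Filter.Tendsto (fun δ : ℝ => (Literature.MathematicalPhysics.KineticTheory.HeatConduction.pinnedChain ω₂ lam β γ).totalCurrent (μ0 (T + δ / 2) (T - δ / 2)) / δ) (nhdsWithin 0 {(0 : ℝ)}ᶜ) (nhds D0) → ∀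 η : ℝ, 0 < η → ∃ ε₂ : ℝ, 0 < ε₂ ∧ ∀ ε : ℝ, 0 < ε → ε ≤ ε₂ → ∀ με : ℝ → ℝ → MeasureTheory.Measure (Literature.MathematicalPhysics.KineticTheory.HeatConduction.PhaseSpace N), (∀ T_L T_R : ℝ, 0 < T_L → 0 < T_R → (Literature.MathematicalPhysics.KineticTheory.HeatConduction.pinnedChain ω₂ lam β γ).IsFlipSteadyState N T_L T_R ε (με T_L T_R) ∧ ∀ ν : MeasureTheory.Measure (Literature.MathematicalPhysics.KineticTheory.HeatConduction.PhaseSpace N), (Literature.MathematicalPhysics.KineticTheory.HeatConduction.pinnedChain ω₂ lam β γ).IsFlipSteadyState N T_L T_R ε ν → ν = με T_L T_R) → ∀ Dε : ℝ, Filter.Tendsto (fun δ : ℝ => (Literature.MathematicalPhysics.KineticTheory.HeatConduction.pinnedChain ω₂ lam β γ).totalCurrent (με (T + δ / 2) (T - δ / 2)) / δ) (nhdsWithin 0 {(0 : ℝ)}ᶜ) (nhds Dε) → |Dε - D0| ≤ η :=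
  response_continuous_in_flipRate

end Summit.AtomisticToContinuum.FouriersLaw.Theorems.FixedLengthNoiseContinuity

end
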